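import Mathlib
import HarnessLib
import HarnessLib.Audit
import Summits.NavierStokesRegularity.Statement
import Summits.NavierStokesRegularity.FluidComputer.PalasekTowerRegisterGlobal
import Summits.NavierStokesRegularity.FluidComputer.PalasekTowerViscosity
import Literature.Analysis.FluidPDE.TaoForcedUniquenessSchwartzForce
import Literature.Analysis.FluidPDE.PalasekObukhovBlowupProof
import Summits.NavierStokesRegularity.FluidComputer.PalasekTowerRegisterGlobalHeredity
import Summits.NavierStokesRegularity.FluidComputer.PalasekTowerClayBridgePathB
import Summits.NavierStokesRegularity.FluidComputer.PalasekTowerHostPreparation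
import Summits.NavierStokesRegularity.FluidComputer.PalasekTowerRegisterGlobalAt
import Summits.NavierStokesRegularity.NavierStokesRegularity.Theorems.NavierStokesBreakdownR3

/-!
Route: PalasekTowerBreakdown

DORMANT since 2026-09-02T20:45:44Z (reconciler: no traction for 5 d (last activity item-evidence-added at 2026-08-28T19:54:54Z); parked, not closed — `ledger route dormant route-NavierStokesRegularity-PalasekTowerBreakdown --off` to rea) — unstaffed, not closed; items shared with open routes are served there. `ledger route dormant <id> --off` reactivates.

# Route PalasekTowerBreakdown — Forced super-lacunary vorticity tower, realised episode by episode
at registered pins, gives Clay (C)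

It suffices to show that Palasek's super-lacunary forced Obukhov tower (Palasek 2026, «Step 2», left
open in print; the MODEL
blow-up is the tree theorem `Literature.Analysis.FluidPDE.Palasek2026_viscousBlowup_holds`) is
realised by ONE true forced
Navier–Stokes flow at unit viscosity on the RE-TUNED rates `TowerRates.tuned` = (N₀, b, β, α) =
(2^24, 33/32, 12/5, 49/20) (Re₀ = N₀^{β−2} = 2^{48/5} ≈ 776, σ = 2^{3/4}, Y₁/Y₀ = 2^{21/20};
RE-BASED 2026-08-27 from `wide` = (256, 11/10, 23/10, 49/20) by the D-0014 fork: at `wide` the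
model's own stretching line is theorem-dead — `palasekTowerBreakdown_burgersWide_missesFloor`, the
Burgers tower line opens only at level 24 — and the collision class tops at 𝔄 1.48 < 2.057 (MODEL,
optimiser line closed), while at `tuned` the MODEL Burgers child (C, λ) = (3/2, 0.9604) passes speed
floor, ceiling, strain floor and core ledger SIMULTANEOUSLY with margin 6/5 under the SAME constants
— `palasekTowerBreakdown_burgersTuned_passes_all_margin`; the `wide` items stay in the file as
standing records with their negatives), split into typed pieces
over the cell's REGISTER v2.3′ (pins Λ = 8, θ = 6/5; schedules RIGID — window equality, c₅ = 4bβ, c₁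
= 1, c₂ = 5/3 — and QUIET — f ≡ 0
after τ₁ (K45); margin = core ledger at readout ∧ strain floor ∧ the GLOBAL level-0 ANCHOR ‖u‖ < Y₀
everywhere on [0, τ₀), so that τ₀ is the
first hitting time of the level-0 floor and no re-timed reading of a tower is a stage (K48)): K1G
`EpisodeBaseT` (= `EpisodeBaseGAt TowerRates.tuned`) — some pinned rigid quiet
schedule (Clay datum, Clay-class force confined to the ball) admits an anchored STAGE AT LEVEL 1
(level-0 host prepared by the push on [0, τ₀), then level 1 — velocity floor Y₁, strain floor A₁,
a core loop of diameter ≤ 2/N₁ with circulation ≥ N₁^{β−2} — grown by the flow itself inside the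
window c₅ log N₁/A₀); and K2G at `tuned`, filed as its two typed pieces `HeredityAtOneT` (=
`HeredityAtGAt TowerRates.tuned 1`: k = 1) and `HeredityFromTwoT` (= `HeredityFromGAt
TowerRates.tuned 2`: every k ≥ 2) — for every pinned rigid quiet schedule, an anchored registered
stage at level k continues to one at
level k+1 (no force at all after τ₁: AUTONOMOUS heredity). The
tree then glues the stages into a `Realisation 1 TowerRates.tuned`, rescales to every viscosity
(`PalasekStep2`), and with Tao's
forced unconditional uniqueness (W14, printed theorem, Literature named fact) yields Clay (C)
`NavierStokesBreakdownR3` — summit-bearing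
under the board rule D-0052 Variant R, closer C. Realises card palasek-ec-bridge.
Lean: `Summit.NavierStokesRegularity.FluidComputer.PalasekTowerClayBridge.EpisodeBaseGAt
Summit.NavierStokesRegularity.FluidComputer.PalasekTowerClayBridge.TowerRates.tuned ∧
Summit.NavierStokesRegularity.FluidComputer.PalasekTowerClayBridge.EpisodeInductionGAt
Summit.NavierStokesRegularity.FluidComputer.PalasekTowerClayBridge.TowerRates.tuned`

## Assembly
K1G (`EpisodeBaseT`) gives a pinned rigid quiet schedule on `tuned` with an anchored stage at level
1; K2G (= `HeredityAtOneT` ∧ `HeredityFromTwoT`, `episodeInductionGAt_of_heredity`) iterates it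
through all levels (the chain `Stage.chain`), the tree glues the
chain into `Realisation 1 TowerRates.tuned` (`nonempty_realisation_of_episodesGAt`, p517439;
R-generic form of `nonempty_realisation_of_episodesPinned`, p406175), rescales to every viscosity
(`palasekStep2_of_realisation`, p404107) and, with `TaoForcedUniqueness` discharging the bridge's
uniqueness hypothesis
(`tao2011_forced_unconditionalUniqueness_velocity.schwartzForce`, p404747), the tree theorem
`navierStokesBreakdownR3_of_step2`
(p403760) yields (C). The deciding theorem `closes` is the one-line composition
`navierStokesBreakdownR3_of_heredityGAt h₁ h₂ h₃` (p517439) over `EpisodeBaseT`, `HeredityAtOneT`,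
`HeredityFromTwoT`; at R = `wide` the generic items ARE the former items of record
(`episodeBaseGAt_wide_iff`, `heredityAtGAt_wide_one_iff`, … by `Iff.rfl`).

CLOSES_TARGET: closes Clay (C): Summit.NavierStokesRegularity.NavierStokesRegularity.NavierStokesBreakdownR3 (board rule D-0052) — the deciding theorem of this route concludes that registered leaf instead of the Statement decl `NavierStokesRegularity` (class clay: a kernel-checked proof closes the summit on the programme's board).

Rationale: WHY THIS LINE. RE-BASE 2026-08-27 (D-0014 fork, tenure planner + DIRECTOR-NS #45): the three cruxes
are now stated at `TowerRates.tuned` = (2^24, 33/32, 12/5, 49/20) — `EpisodeBaseT`,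
`HeredityAtOneT`, `HeredityFromTwoT` := the R-generic `EpisodeBaseGAt / HeredityAtGAt · 1 /
HeredityFromGAt · 2` of p517439 at R = tuned — because at the former register `wide` = (256, 11/10,
23/10, 49/20) the model's own stretching line is theorem-dead
(`palasekTowerBreakdown_burgersWide_missesFloor`: every Burgers child core with C√λ ≤ 13 misses the
level-1 speed floor everywhere; the Burgers tower line opens only at level 24, p518152) and the
measured collision class tops at 𝔄 1.48 < FLOOR 2.057 (MODEL; optimiser line closed 2026-08-27),
whereas at `tuned` the MODEL Burgers child (3/2, 0.9604) meets floor (6/5)Y₁ / ceiling (25/18)Y₁ /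
strain (6/5)A₁ / core (6/5)N₁^{β−2} simultaneously with margin 6/5 under the ORIGINAL constants
(p518674) and the original pins (8, 6/5) and Rigid c₂ = 5/3 stay admissible (`tuned_sep : 2Y_k ≤
Y_{k+1}`). What the re-base does NOT buy (recorded honestly): the free-run EXISTENCE face of K1 is
exactly as open; window 0 is 169.8 level-0 strain times (wide: 61.7); the sup-norm shadowing
certificate road (p509799/p510647/p511595/p515004) is priced out at both registers (exponent ∝
cap²·s₀, ×410 worse at tuned); wide-pinned door files need ONE rescaling door (REBASE-TURNKEY-v1
§3); and the MODEL motive rests on the circulation ENDOWMENT of the child core being the natural C ≈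
3/2 multiple of its floor (p433323) — refuter4 K193 rider R1 `K193_fourClauses_free_endowment`: with
(C, λ) free the four level-(k+1) clauses are feasible at EVERY admissible register (binding law
C·B_k ≥ 500π/79 ≈ 19.88, i.e. C ≥ 15.1 at wide level 0 vs C ≥ 1.2 at tuned), so the load-bearing
untyped input is the ENDOWMENT BUDGET law C_{k+1} ≤ f(C_k, σ_k) (Kelvin: a drawn-out tube carries at
most the parent's circulation while the floor grows by σ_k^{β−2} per level — the folding
multiplicity m_k of the barrier placement), typed nowhere yet: a support statement to be filed under
HeredityAtOneT. The `wide` items `EpisodeBase` / `HeredityAtOne` / `HeredityFromTwo` stay in the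
file as `aside` standing records with all their negatives (CapClassSterile, Disproof v7/v8,
CapStratum*, KJ-37's Kelvin placement) attached; numbers quoted «at wide» in the paragraphs below
are the rev-16 record and stay true of those records. ORIGINAL RATIONALE (rev 16) FOLLOWS.
Palasek2026ElementaryModel proves finite-time blow-up for every ν > 0 of a forced dyadic model whose
levels are vortex structures of
frequency N_k = N₀^{b^k} and velocity N_k^{β−1} (β > 2: Type II), driven through Fefferman's force
slot, and leaves the transfer to
true NS («Step 2», §4) open; the cell typed the endpoint
(`Schedule`/`Stage`/`Realisation`/`PalasekStep2`, the bridge to (C)) and its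
refuters killed two weaker typings (junk stage S₀ under uniqueness; tail re-timing), which is WHY
the register pins impulse, strain,
core and — new here — the CLOCK (window equality: every readout time is level-0 data) and the
constants by value. Imported: the
force slot (C) (what the (A)-routes Theses/Blowup, Theses/CertifiedBlowup cannot use) for the
preparation of level 0; the Kelvin
ceiling `Literature.Barriers.NavierStokesRegularity.PalasekTowerKelvinCeiling` as the named
obstruction, evaded by making its
hypothesis (H-core) FAIL by design (the core ledger demands circulation ≥ N_j^{β−2} on loops of
length ≍ 1/N_j, i.e. compaction,
evasion (1)); computer-assisted instability certificates (the cell's X0: a theorem-grade real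
unstable eigenvalue of the class-II
linearisation about forced ABC at R = 100 in (0.1441, 0.1461)) as the technology for the first rung.
Nothing in the negatives index has
the K1R/K2R shape; the two killed typings are recorded in the route's own kernel files (JunkStage,
tail re-timing).

RANKED CRUXES. AFTER THE RE-BASE: #2 `HeredityAtOneT` (crux, rank 2) — heredity of DESIGNS at level
1 on `tuned` (hand-over 1 → 2, folding multiplicity m₁ = (N₂/N₁)^{β−2} = 2^{99/320} ≈ 1.24; why it
might fail: autonomous compaction may be false — the MODEL needs maintenance forcing at every level,
printed reconnections transfer ≤ ½ the circulation and thicken cores, and the Kelvin rate-free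
ceiling `of_not_bddAbove` is evaded ONLY by evasion (1), the folding multiplicity; sources
Palasek2026ElementaryModel §4, MoffattKimura2019,
Literature.Barriers.NavierStokesRegularity.of_not_bddAbove) · #2 `HeredityFromTwoT` (crux, rank 2) —
the same from level 2 on (generic range; why it might fail: as above plus the level-uniformity of
constants) · #3 `EpisodeBaseT` (crux, rank 3) — K1 at `tuned`: a pinned rigid quiet schedule with a
globally anchored strained cored Stage at level 1 (why it might fail: the free-run existence face —
a classical free/self-run meeting cap, speed, core and strain faces inside a window of 169.8 strain
times — is open; viscosity may win or the ceiling be overshot before the core forms; sources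
Palasek2026ElementaryModel §3–4, arXiv:2605.13827, p517439, p518674) · #9 TaoForcedUniqueness
(support, unchanged) · ASIDE (standing records at `wide`): EpisodeBase (19179), HeredityAtOne
(19249), HeredityFromTwo (19250). REV-16 TEXT FOLLOWS. #2 EpisodeInduction (crux) — K2G of record
(register v2.3′) — for every schedule on the wide-base rates satisfying the pins (Λ = 8, θ = 6/5,
datum and force [deps: EpisodeBase] [difficulty: open-problem] (why it might fail: Autonomous
compaction k→k+1 may be false (MODEL needs maintenance forcing at every level; printed reconnections
transfer ≤ ½ the circulation and thicken cores; the rigid clock may miss the hand-over); a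
relabelling lever beyond K35/K48 (dead by window_eq / ANCHOR) may still hide in ∀S.)
[Palasek2026ElementaryModel, MoffattKimura2019, arXiv:2006.05796, arXiv:1908.01804,
Literature/Barriers/NavierStokesRegularity/PalasekTowerKelvinCeiling]
#3 EpisodeBase (crux) — K1G of record (register v2.3′) — there is a RIGID, QUIET schedule on the
wide-base rates satisfying the pins whose Clay datum [difficulty: XL] (why it might fail: The 0→1
compaction must reach circulation N₁^{0.3} on a 2/N₁-loop and strain A₁ within 62 strain times at
DC1 margin A₀/N₁² = 1.74 only: viscosity may win, or the ceiling (5/3)Y₁ may be overshot before the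
core forms; the ANCHOR needs a monotone first approach to Y₀.) [Palasek2026ElementaryModel,
arXiv:2605.13827, doi:10.1017/S0022112003006530, MoffattKimura2019]
#9 TaoForcedUniqueness (support) — Tao 2013, Cor. 11.4 with forcing, velocity form (W14): two
classical finite-energy solutions of forced NS on [0, T] × ℝ³ [difficulty: L] [Tao2011,
arXiv:1108.1165]

TWO-LAYER PLAN. PARENT NODE (DIRECTOR-NS 2026-08-25T21:21Z): above the register pair sits the
rate-free deliverable `ForcedClayBlowup` (Literature vocabulary —
classical forced solution on [0,T) with Clay datum/force smooth through T, finite slab energies,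
velocity unbounded on [0,T) × B̄(0,r);
HOME/plan/route-draft-v3, farm-certified with its own 45-line `closes` to (C)): EpisodeBase →
EpisodeInduction → ForcedClayBlowup → (with W14) (C).
It is NOT an item of this route (the deciding theorem composes the register closer directly); it is
the typed carrier of the same split
if the route must be born before the FluidComputer vocabulary is importable (STEP 1′, conditional
bridge on `PalasekStep2`).
EpisodeInduction ⇐ HeredityAtOne (the crux at its first level k = 1: hand-over 1 → 2, N₁ ≈ 445 → N₂
≈ 819 — the BC5 rung, plan-only,
technique ANALYTIC single-episode construction — stability of the strained level-1 host over the
unforced window with the level-2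
readouts by perturbation about the Burgers-vortex/strained-tube profile; NOT validated numerics: an
ℝ³ forced-NS IVP enclosure at these
floors is not purchasable with 2026 technology, cap HOME/cap/K1R-CAP-PRICE.md 540a69505a87ad98;
`heredityAtOne_of_episodeInductionG`
proves it is a truncation OF the crux) → ContinuationEnvelope (k ≥ 2, UPPER half: every registered
stage continues classically with finite energy
to τ_{k+1} inside the ceiling c₂Y_{k+1} — no premature blow-up, no overshoot) → ReadoutFloors (k ≥
2, LOWER half, the autonomy bet: every
such continuation has at τ_{k+1}, in the ball, the velocity floor, the strain floor and the
level-(k+1) core loop) → EpisodeInduction —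
composition `EpisodeInductionG_of` kernel-checked (BC3 skeleton, case split k = 1 / k ≥ 2; numerics
where N is small, asymptotics
(Re_k, DC1_k increasing) where it is large). EpisodeBase ⇐ HostPreparation (∃ pinned rigid quiet
schedule
with an anchored stage at level 0: datum + free push on [0, τ₀)) → FirstEpisode (heredity at k = 0,
the numerically reachable rung N₁ ≈ 445) →
EpisodeBase — `EpisodeBaseG_of` kernel-checked. Later children of ReadoutFloors: a Burgers-type
compaction lemma (strained level-k
structure concentrates circulation ≥ N_{k+1}^{β−2} at scale 1/N_{k+1}) and a certified
linear-instability input of X0 type.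

KILL CRITERIA. Refuted outright (close --reason refuted:EpisodeInduction) by an NS-side theorem
exhibiting a pinned rigid schedule with a genuine
registered stage at some level k ≥ 1 whose classical continuation stays below Y_{k+1} in the ball at
τ_{k+1} (autonomy false), or by a
circulation/strain ceiling showing that no classical flow under the ceiling (5/3)Y_k can raise loop
circulation from N_k^{β−2} at
scale 1/N_k to N_{k+1}^{β−2} at scale 1/N_{k+1} within c₅ log N_{k+1}/A_k (a flux maximum principle
— none in print either way).
SETTLED MISSTATEMENTS (negative edges of the UN-anchored predecessors, not of these items): K35
one-gap re-timing (dead by window_eq,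
register v2.1) and K48 uniform re-timing S ↦ S^E (refuter g9 22:38Z: {K1Q, K2Q, hU} + a persistence
rider ⊢ ⊥; dead by the ANCHOR,
register v2.3; Phase-D kernel HOME/refuter/ShiftStage.lean e837b8b6c9fab90d, farm rc 0 / 0 sorry:
`EpisodeInductionQ.isEmpty_stage_shift`,
`EpisodeInductionQ.not_persistent_tower` (negative lemmas on the Q/R inductions modulo hU + rider)
and `Stage.isEmpty_anchored_shift`
(the lever is dead under the ANCHOR — any margins, any rates)); K49 radius corners (E) δ-early read
in an enlarged ball / (L) late read in a
shrunken ball of the BALL-GUARDED anchor (refuter g9 22:56Z) — dead by the GLOBAL anchor (register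
v2.3′, RULING K49; refuter P6/P7).
MISSTATED-CLASS exposure declared in advance (FAR-SEED ADVERSARY, planner desk 21:05Z): K2G
quantifies over ALL registered stages,
including histories that carry, far from the core, an UNFORCED near-Type-I blow-up seed (speed ≤
(5/3)Y_k, size ≲ 10²/N_k, timed to
break down inside window k: scale-invariantly admissible at large k because Y_k²·w_k ≍ Re_k log
N_{k+1} → ∞); the register pins the
core loops existentially (CoreLedger) and does not pin far-field quietness, so IF unforced blow-up
of that rate class exists and can be
planted with readout slack, K2G fails at large k while (C) may stand. No refutation is available
from it today (no blow-up is known),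
and a refuter theorem of this shape is classed refuted-MISSTATED with the repair of record = one
more pin (far-field quietness: vorticity
outside B(0, radius) small in a scale-invariant norm at every τ_j), filed as a new item
`EpisodeInductionFar`; it is NOT the autonomy bet.
Pivot (not death): if EpisodeBase is refuted for the wide register only (constants), re-register on
`TowerRates.deep`/`Registry.deep`
(Shape-E vocabulary, p406752) — a sibling route, not an edit; if K2G dies SUBSTANTIVELY on autonomy,
the successor opens Shape-E
(`UniformDepthTowers` + `TowerCompactness`, force used at every depth) as the sibling route sharing
the (C) closer. Mooted if W14's
Lean discharge changes the uniqueness class (the bridge already runs on the Schwartz-force special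
case). MODEL words of the cell
(X1″, X3″, P-TOWER-1′ P1 at R = 300/500) are killable-this-week evidence, not items: a NEGATIVE P1
word at both R retires the ABC
instance of HostPreparation's technology, not the crux.

NOT DECOMPOSED YET. The compaction mechanism inside ReadoutFloors (which strained structure, which
reconnection/bundling event raises co-signed flux by
(N_{k+1}/N_k)^{β−2} per level), the a-priori envelope inside ContinuationEnvelope, and the host
family of HostPreparation are layer-2
and are NOT filed as items at open (D-0019: two layers max; the BC3 stubs are registered lines, not
items). The registered numbers
(wide rates, Λ = 8, θ = 6/5, c₁ = 1, c₂ = 5/3, c₅ = 4bβ) are fixed by the register file and are not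
parameters of the items. The X0
certificate and the other MODEL words are evidence attached to EpisodeBase, never items (BC6). QUIET
(K45) and the GLOBAL ANCHOR (K48/K49) are in the
items AT BIRTH (register v2.3′; the v2.1/v2.2/v2.3 pairs …R, …Q and the ball-guarded …A stay in the
tree as predecessors: A-induction ⊢ G-induction, G-base ⊢ A-base). One post-birth swap is
PRE-ANNOUNCED (route edit, not re-filing): the W14 debt of the support item is discharged along PATH
B of LIT §41 (forced Serrin–Masuda weak–strong uniqueness [Sohr 2001 Thm V.1.5.1]
+ forced Tao Lemma 44 energy inequality for the smooth finite-energy competitor + Serrin-class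
typing of the designed solution from the register
ceilings; ≈ 3.8k lines, half of PATH A), via a bridge variant taking those two facts in place of the
unconditional-uniqueness slot.

CHEAPEST FALSIFIER. The refuter's junk-inhabitant re-probe P1–P4 on the REGISTERED pair
(pre-registered, STATUS l.999/l.1015/l.1039): (P1) re-tune the
junk stage S₀ (Gaussian blob + cancelling force) against the pins — dead by `Pins.impulse`/strain
(kernel JunkStage Phase A′) and by
`Stage.false_of_separable` (no pinned stage is separable a(t)V(x), p406747 PENDING at the gate,
concat-checked); (P2) Gavrilov/steady-Euler blobs — same lemma; (P3) tail
re-timing — dead by `Rigid.τ_eq_of_τ_zero_eq` (same τ₀ ⇒ same readout times; the kill itself is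
kernel-checked against the UNREGISTERED
pair for every tail-blind margin: refuter `not_episodeInduction_of_episodeBase`,
HOME/refuter/JunkStage.lean f544ad847a23969e §ReTiming, whose
docstring confirms `Margins.register` is not tail-blind); (P4) autonomy — exhibit a strained stage
whose cut-off
continuation misses the next floor: a MODEL-side witness is a warning, an NS-side one kills K2G. I
ran P3 in the kernel (lemma
proved, rc 0); P1/P2/P4 are the refuter's this week.

NUMBERS. Wide-base rates (256, 11/10, 23/10, 49/20): N₁ ≈ 445, Y₀ = 256^{1.3} ≈ 1351, Y₁ ≈ 2778, A₀
= 256^{2.3} ≈ 3.45·10⁵, A₁ ≈ 1.23·10⁶,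
Y_{k+1}/Y_k = N_k^{0.13} ≥ 2.06 (`TowerRates.wide_sep`: 2Y_k ≤ Y_{k+1}); window w₀ = c₅ log N₁/A₀ ≈
1.8·10⁻⁴ = 62 strain times
(c₅ = 4bβ = 10.12); the registered schedule class is NON-EMPTY (zero datum/force schedule with Pins
8 (6/5) ∧ Rigid, c₃ = 32:
`TowerRates.exists_registered_schedule`, lean g2 HOME/lean/PalasekTowerRegisterWindow.lean
155d282718bd55d5, held for p407242; refuter K36 re-derived
the window arithmetic); admissible impulse per window ≤ c₄Y_k w_k ≤ 0.25 at k = 0 versus jump ≥ Y₁ −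
(5/3)Y₀ ≈ 526 (Λ = 8 leaves ≤ 66);
DC1 margin A_k/N_{k+1}² = N_k^{β−2b} = N_k^{0.1} (= 1.74 at k = 0, → ∞); Type-II rate |u|(T−t)^{1/2}
≍ N_k^{0.15};
Reynolds numbers per level (scaling invariants) Re_k = Y_k/N_k = N_k^{0.3} = 5.3, 6.2, 7.5, 9.2,
11.4 (k = 0…4); window in
level-k viscous times c₅ log N_{k+1}/Re_k = 11.7, 10.9, 10.0 (refuter K35 §6: unparented structures
must budget ≈ 11 e-folds of plain
diffusion at core scale — a design number of K1R, not an inconsistency); Palasek normalisation c ≤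
½ln(4/3) ≈ 0.1438 (Lemma 3.2; cell decision l.718); X0 bracket (0.1441, 0.1461) at R = 100, class II
(theorem-grade, computer-assisted; MODEL). Required per-level flux gain (N_{k+1}/N_k)^{β−2} =
N_k^{0.03}; printed reconnection budgets:
circulation transfer ≤ ½ (Kerr 2013; Yao–Hussain 2020–22), merging gains ≤ 1.22×.

DEFINITION REQUESTS. LANDED: `Schedule`, `Margins`, `Stage`, `Stage.Extends`,
`Realisation.ofEpisodes` (PalasekTowerEpisodes, p404510); `Schedule.Pins`,
`Margins.withStrain`, `EpisodeBasePinned`, `EpisodeInductionPinned`,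
`nonempty_realisation_of_episodesPinned`, `TowerRates.wide`
(PalasekTowerEpisodesPinned, p406175, ACCEPTED); `circulation` (Literature Vorticity). IN THE TREE
before `closes` elaborates: the REGISTER
modules `FluidComputer/PalasekTowerRegister.lean` (p407242, 5452e47c8128: `Schedule.Rigid`,
`CoreLedger`, `Margins.register`),
`…RegisterQuiet.lean` (p409896, 5a7adf104927: `Schedule.Quiet`) and `…RegisterAnchored.lean`
(register v2.3, lean g2, p410578 eac0f0ad8e10: `Margins.anchor`, `EpisodeBaseA/InductionA`
(ball-guarded
anchor) and `…RegisterGlobal.lean` = register v2.3′ (GLOBAL anchor, RULING K49/K49′; refuter g9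
bytes a25acc6ef198e56c): `Schedule.AnchorGlobal`, `Margins.routeG`, `@[conjecture] EpisodeBaseG`,
`@[conjecture] EpisodeInductionG`, `nonempty_realisation_of_episodesG`, closer
`navierStokesBreakdownR3_of_episodesG : EpisodeBaseG →
EpisodeInductionG → W14 → NavierStokesBreakdownR3`). Cite fact wanted: none new (W14
exists as `tao2011_forced_unconditionalUniqueness_velocity`; Schwartz-force bridge p404747).

Novelty: Searches (2026-08-25, cell literature seats lit g4/g5 + lit2, labelled): corpus fts + hybrid «forced
Navier-Stokes blow-up smooth force»,
«Obukhov model embedding Navier–Stokes», vsearch «smooth data smooth force finite time singularity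
three dimensions»; arXiv year ≥ 2026 ×4
queries; `lit citing arxiv:2605.13827` = 0 citers; galaxy star-all «Obukhov model|dyadic model of
the Navier|shell model blow» (models
only: [galaxy:pdf:1785924600] Cheskidov 2008, [galaxy:pdf:3093001900] Campolina–Simonnet–Thalabard
2025); galaxy pdf «computer-assisted
proof» 99 docs / «ABC flow» 51 docs, 0 certified 3-D NS instabilities; `lean search 'PalasekStep2'`
(tree only).
Nearest prior art found: Palasek2026ElementaryModel [corpus:paper-arxiv-2605.13827 p0003 L15–L21
two-step programme; p0012 §4
«plausible candidate to be embedded in the full 3D Navier–Stokes equations», two notions of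
embedding] — Step 2 NOT claimed in print;
Tao 2016 averaged blow-up [corpus:paper-arxiv-1402.0290 p0007 Thm 1.5] (averaged bilinear form, tree
barrier `TaoAveragedBlowup`);
Galdi–Gazzola 2026 [corpus:paper-arxiv-2606.15189 p0015 Thm 4.11, p0016 Thm 4.15] and Gazzola 2026
[corpus:paper-arxiv-2608.18802 p0002
Thm 2.2] (PRESCRIBED-velocity forced blow-ups whose force fails exactly at T the class where the
matching no-blow-up theorem holds — not
Clay (C)); Seregin 2026 [corpus:paper-arxiv-2606.29468 p0005 Thm 2.1] (necessary conditions, no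
construction); controllability of 3D NS by smooth
finite-mode forcing on 𝕋³ [co  [refs: 2605.13827, arxiv:2605.13827, paper-arxiv-2605.13827, paper-arxiv-1402.0290, paper-arxiv-2606.15189, paper-arxiv-2608.18802, paper-arxiv-2606.29468, paper-shirikyan2006-approximate-controllability-three-dimensional-navierstokes-equatio, paper-arxiv-2009.05449]

Barriers (technique_class: forced-vorticity-tower, episode-induction, CAP): - technique_class: forced-vorticity-tower, episode-induction, CAP
- Literature.Barriers.NavierStokesRegularity.PalasekTowerKelvinCeiling: the barrier quantifies over
WINDING-ONE towers whose ONE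
  co-signed structure carries circulation Γ_k ≥ c·N_k^{β−2} on a loop that stays long
((H-core)/(H-single)). PLACEMENT OF RECORD
  (corrected 2026-08-26 after refuter4 K57-W, kernel
`Theorems/HeredityAtOne/Negative/CoreLedgerWinding.lean` p432770:
  `circulation_comp_natMul`, `coreLoop_of_winding`, `coreLedger_of_winding`): AS TYPED (register G)
the core-ledger clause
  `c₁N_j^{β−2} ≤ ∮u(τ_j)·dℓ` ranges over ANY periodic C¹ loop in B̄(x,1/N_j) of speed ≤ 8π/(mN_j)
and pins no winding number, so it is a
  vorticity-AMPLITUDE floor (≳ c₁A_j/(4π) on some sub-1/N_j disc), NOT a circulation floor —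
registered stages need not meet (H-core) at
  all, i.e. the typed cruxes sit OUTSIDE the barrier's hypothesis class for a TYPING reason, not by
mechanism, and the cruxes 19249/19250
  assert an amplitude ladder. Under the INTENDED register (banked amendment v2.4′ (r2): winding-one
ROUND core loops of radius ∈
  [1/(2N_j), 1/N_j], equivalently the flux form ∫_D ω·n ≥ c₁N_j^{β−2} by Stokes) the clause IS
circulation ≥ c₁N_j^{β−2} per level and the
  placement becomes: OUTSIDE by construction — (H-single) (one structure, one loop transported level
to level with conserved circulation)
  FAILS: each level's core loop is a NEW loop of length ≍ 1/N_j (compaction, evasion (1)),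
circulation along materia

History (route lifecycle, newest last):
- 2026-09-02T20:45:44Z · DORMANT — reconciler: no traction for 5 d (last activity item-evidence-added at 2026-08-28T19:54:54Z); parked, not closed — `ledger route dormant route-NavierStokesRegula (operator:999:3465364)

sub-problem: NavierStokesRegularity · status: dormant · opened planner-ns-blowup-plan-g16-0 2026-08-26T00:09:57Z · rev 19 · ledger route-NavierStokesRegularity-PalasekTowerBreakdown
GENERATED by the gate from the ledger (D-0016/17). Provers cite these decls: `theorem foo : Summit.NavierStokesRegularity.NavierStokesRegularity.Theses.PalasekTowerBreakdown.<Decl> := …` in Summits/NavierStokesRegularity/NavierStokesRegularity/Theorems/<Name>.lean.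
-/

namespace Summit.NavierStokesRegularity.NavierStokesRegularity.Theses.PalasekTowerBreakdown

open scoped BigOperators Topology Manifold Classical MeasureTheory ProbabilityTheory Matrix InnerProductSpace ComplexConjugate ContinuousMap
open Filter Set Function TopologicalSpace MeasureTheory

attribute [summit_statement] _root_.NavierStokesRegularity
attribute [summit_statement] _root_.Summit.NavierStokesRegularity.NavierStokesRegularity.NavierStokesBreakdownR3

open Literature.NS

/-- item stmt-NavierStokesRegularity-20304 · crux · rank 2 · open · by planner
why it might fail: Autonomous compaction 1->2 may be false: MODEL needs maintenance forcing at every level, reconnections transfer <= 1/2 the circulation and thicken cores; Kelvin rate-free ceiling evaded only by folding multiplicity m1 ~ 1.24; endowment budget law untyped (K193 R1).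
sources: Palasek2026ElementaryModel, MoffattKimura2019, arXiv:2006.05796, Literature.Barriers.NavierStokesRegularity.of_not_bddAbove, p517439
[crux] RE-BASE (D-0014 fork, DIRECTOR-NS #45): heredity of DESIGNS at level 1 on TowerRates.tuned =
(2^24, 33/32, 12/5, 49/20) — every globally anchored strained cored Stage at level 1 over a pinned
(8, 6/5) rigid quiet schedule extends to level 2 (hand-over 1 -> 2; folding multiplicity m1 =
(N2/N1)^(beta-2) = 2^(99/320) ~ 1.24). Why it might fail: autonomous compaction may be false — the
MODEL needs maintenance forcing at every level, printed reconnections transfer <= 1/2 the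
circulation and thicken cores; the Kelvin rate-free ceiling of_not_bddAbove is evaded ONLY by
evasion (1), the folding multiplicity; the endowment budget law C_{k+1} <= f(C_k, sigma_k) is
untyped (refuter4 K193 R1). Sources: Palasek2026ElementaryModel §4; MoffattKimura2019;
arXiv:2006.05796; Literature.Barriers.NavierStokesRegularity.of_not_bddAbove; p517439. -/
@[route_item "route-NavierStokesRegularity-PalasekTowerBreakdown"]
def HeredityAtOneT : Prop :=
  Summit.NavierStokesRegularity.FluidComputer.PalasekTowerClayBridge.HeredityAtGAt Summit.NavierStokesRegularity.FluidComputer.PalasekTowerClayBridge.TowerRates.tuned 1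

/-- item stmt-NavierStokesRegularity-20305 · crux · rank 2 · open · by planner
why it might fail: As HeredityAtOneT plus level-uniformity of the constants for all k >= 2; a relabelling lever beyond window equality / ANCHOR may still hide in the forall over schedules; Kelvin ceiling evaded only by m_k = (N_{k+1}/N_k)^(beta-2).
sources: Palasek2026ElementaryModel, MoffattKimura2019, arXiv:1908.01804, Literature.Barriers.NavierStokesRegularity.of_not_bddAbove, p517439
[crux] RE-BASE (D-0014 fork, DIRECTOR-NS #45): heredity of DESIGNS from level 2 on, on
TowerRates.tuned = (2^24, 33/32, 12/5, 49/20) — for every k >= 2, every globally anchored strained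
cored Stage at level k over a pinned (8, 6/5) rigid quiet schedule extends to level k+1 (generic
range; no force after tau1: AUTONOMOUS heredity). Why it might fail: as HeredityAtOneT plus
level-uniformity of the constants; a relabelling lever beyond window equality / ANCHOR may still
hide in the forall over schedules; Kelvin rate-free ceiling evaded only by folding multiplicity m_k
= (N_{k+1}/N_k)^(beta-2). Sources: Palasek2026ElementaryModel §4; MoffattKimura2019;
arXiv:1908.01804; Literature.Barriers.NavierStokesRegularity.of_not_bddAbove; p517439. -/
@[route_item "route-NavierStokesRegularity-PalasekTowerBreakdown"]
def HeredityFromTwoT : Prop :=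
  Summit.NavierStokesRegularity.FluidComputer.PalasekTowerClayBridge.HeredityFromGAt Summit.NavierStokesRegularity.FluidComputer.PalasekTowerClayBridge.TowerRates.tuned 2

/-- item stmt-NavierStokesRegularity-20303 · crux · rank 3 · open · by planner
why it might fail: Free-run EXISTENCE face at tuned (free/self-run meeting cap, speed, core, strain faces inside window 0 = 169.8 strain times) is as open as at wide; viscosity may win or the ceiling be overshot; sup-norm certificate road priced out (x410 vs wide).
sources: Palasek2026ElementaryModel, arXiv:2605.13827, p517439, p518674, refuter4-K193
[crux] RE-BASE (D-0014 fork, DIRECTOR-NS #45): K1 at the re-tuned register TowerRates.tuned = (2^24,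
33/32, 12/5, 49/20) (Re0 ~ 776; original pins (8, 6/5), Rigid c2 = 5/3 admissible, p517439): some
pinned rigid quiet schedule admits a globally anchored strained cored Stage at level 1. Why it might
fail: the free-run EXISTENCE face (a classical free/self-run meeting cap, speed, core and strain
faces inside window 0 = 169.8 level-0 strain times) is as open as at wide; viscosity may win or the
ceiling (5/3)Y1 be overshot before the core forms; the sup-norm certificate road is priced out
(exponent x410 vs wide). Sources: Palasek2026ElementaryModel §3-4; arXiv:2605.13827; p517439;
p518674 (MODEL Burgers child passes all four faces at tuned, margin 6/5); refuter4 K193. -/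
@[route_item "route-NavierStokesRegularity-PalasekTowerBreakdown"]
def EpisodeBaseT : Prop :=
  Summit.NavierStokesRegularity.FluidComputer.PalasekTowerClayBridge.EpisodeBaseGAt Summit.NavierStokesRegularity.FluidComputer.PalasekTowerClayBridge.TowerRates.tuned

/-- item stmt-NavierStokesRegularity-19178 · aside · rank 2 · SPLIT (gen 1) into HeredityAtOne, HeredityFromTwo + glue Summit.NavierStokesRegularity.FluidComputer.PalasekTowerClayBridge.HeredityAt.heredityFrom · direct attempts still welcome (low priority) · by planner
why it might fail: Autonomous compaction k→k+1 may be false (MODEL needs maintenance forcing at every level; printed reconnections transfer ≤ ½ the circulation and thicken cores; the rigid clock may miss the hand-over); a relabelling lever beyond K35/K48 (dead by window_eq / ANCHOR) may still hide in ∀S.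
sources: Palasek2026ElementaryModel, MoffattKimura2019, arXiv:2006.05796, arXiv:1908.01804, Literature/Barriers/NavierStokesRegularity/PalasekTowerKelvinCeiling
[crux] K2G of record (register v2.3) — for every schedule on the wide-base rates satisfying the pins
(Λ = 8, θ = 6/5, datum and force [deps: EpisodeBase] [difficulty: open-problem] -/
@[route_item "route-NavierStokesRegularity-PalasekTowerBreakdown"]
def EpisodeInduction : Prop :=
  Summit.NavierStokesRegularity.FluidComputer.PalasekTowerClayBridge.EpisodeInductionG

-- parent: EpisodeInduction · child (gen 1)
/--     item stmt-NavierStokesRegularity-19249 · aside · rank 201 · open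
    parent: EpisodeInduction · by planner
    why it might fail: TECHNIQUE (analysis, not numerics): designed vortex-tube collision / strained Burgers-tube compaction at scale 1/N₂ in window 1 with perturbative energy+Serrin control (stay < c₂Y₂, meet the level-2 floors at τ₂). Fails if compaction at Re_Γ ≤ 42·N₂^0.3 cannot outrun viscous spreading within w₁.
    sources: Palasek2026ElementaryModel, MoffattKimura2019JFM, STATUS l.2122, tribunal J round 1 (a)
[crux, rank 3 — the FIRST RUNG of K2G = the route's BC5 witness-of-weakness target and first prover
target; planner BC3 stub heredity_at_one verbatim, p415576 `HeredityAtOne`] every globally anchored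
registered stage at level 1 of a pinned, rigid, quiet schedule on the wide-base rates extends to one
at level 2 — the single hand-over 1 → 2 (N₁ = 256^{1.1} ≈ 445 → N₂ ≈ 819, window c₅ log N₂ / A₁,
unit viscosity, no force after τ 1). A truncation OF the crux (`EpisodeInductionG.heredityAtOne`),
one level below K2G's generic range; with EpisodeBaseG it gives `RungG 2`
(`rungG_two_of_heredityAtOne`). -/
@[route_item "route-NavierStokesRegularity-PalasekTowerBreakdown"]
def HeredityAtOne : Prop :=
  Summit.NavierStokesRegularity.FluidComputer.PalasekTowerClayBridge.HeredityAtOne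

-- parent: EpisodeInduction · child (gen 1)
/--     item stmt-NavierStokesRegularity-19250 · aside · rank 202 · open
    parent: EpisodeInduction · by planner
    why it might fail: TECHNIQUE: the level-1 argument rescaled by b^k — a-priori sup bound c₂Y_{k+1} on every finite-energy continuation (ContinuationEnvelope ↔ a-priori ceiling, p422740) + autonomous strained-tube compaction to the level-(k+1) floors. Fails if constants drift with k or energy cannot fund the floors.
    sources: Palasek2026ElementaryModel, STATUS l.2063, STATUS l.2363, tribunal J round 1 (a)
[crux, rank 2 — the parent minus its first rung] Heredity FROM level 2 on (p415576 `HeredityFrom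
2`): for every pinned (Λ = 8, θ = 6/5), rigid, quiet schedule on the wide-base rates and every level
k ≥ 2, every globally anchored registered stage at level k (margins routeG, unit viscosity, no force
after τ 1) extends to one at level k + 1. With HeredityAtOne it is EXACTLY K2G
(`episodeInductionG_iff_heredityAtOne_and_heredityFrom_two`, kernel). -/
@[route_item "route-NavierStokesRegularity-PalasekTowerBreakdown"]
def HeredityFromTwo : Prop :=
  Summit.NavierStokesRegularity.FluidComputer.PalasekTowerClayBridge.HeredityFrom 2

/-- glue for the split of `EpisodeInduction`: landed theorem `Summit.NavierStokesRegularity.FluidComputer.PalasekTowerClayBridge.HeredityAt.heredityFrom`. -/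
theorem EpisodeInductionGlueBy_holds : HeredityAtOne → HeredityFromTwo → EpisodeInduction := _root_.Summit.NavierStokesRegularity.FluidComputer.PalasekTowerClayBridge.HeredityAt.heredityFrom

/-- item stmt-NavierStokesRegularity-19179 · aside · rank 3 · open · by planner
why it might fail: The 0→1 compaction must reach circulation N₁^{0.3} on a 2/N₁-loop and strain A₁ within 62 strain times at DC1 margin A₀/N₁² = 1.74 only: viscosity may win, or the ceiling (5/3)Y₁ may be overshot before the core forms; the ANCHOR needs a monotone first approach to Y₀.
sources: Palasek2026ElementaryModel, arXiv:2605.13827, doi:10.1017/S0022112003006530, MoffattKimura2019, Literature/Barriers/NavierStokesRegularity/PalasekTowerKelvinCeilingRateFree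
[crux] K1G of record (register v2.3) — there is a RIGID, QUIET schedule on the wide-base rates
satisfying the pins whose Clay datum [difficulty: XL] -/
@[route_item "route-NavierStokesRegularity-PalasekTowerBreakdown"]
def EpisodeBase : Prop :=
  Summit.NavierStokesRegularity.FluidComputer.PalasekTowerClayBridge.EpisodeBaseG

/-- item stmt-NavierStokesRegularity-19180 · aside · rank 9 · closed · proved by Summit.NavierStokesRegularity.NavierStokesRegularity.Theorems.taoForcedUniqueness_proof (prover) · by planner
sources: Tao2011, arXiv:1108.1165
[support] Tao 2013, Cor. 11.4 with forcing, velocity form (W14): two classical finite-energy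
solutions of forced NS on [0, T] × ℝ³ [difficulty: L] -/
@[route_item "route-NavierStokesRegularity-PalasekTowerBreakdown"]
def TaoForcedUniqueness : Prop :=
  Literature.Analysis.FluidPDE.tao2011_forced_unconditionalUniqueness_velocity

-- `TaoForcedUniqueness` holds: proved by `Summit.NavierStokesRegularity.NavierStokesRegularity.Theorems.taoForcedUniqueness_proof` (its module imports this route file, so no `_holds` link can be stated here).

/-- item stmt-NavierStokesRegularity-19181 · assembly · rank 1 · closed · proved by Summit.NavierStokesRegularity.NavierStokesRegularity.Theorems.palasekTowerBreakdown_assembly_proof (prover) · by planner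
sources: Palasek2026ElementaryModel, FeffermanClay2006, Tao2011
[assembly] EpisodeBase → EpisodeInduction → TaoForcedUniqueness → NavierStokesBreakdownR3 -/
@[route_item "route-NavierStokesRegularity-PalasekTowerBreakdown"]
def Assembly : Prop :=
  EpisodeBase → EpisodeInduction → TaoForcedUniqueness → Summit.NavierStokesRegularity.NavierStokesRegularity.NavierStokesBreakdownR3

-- `Assembly` holds: proved by `Summit.NavierStokesRegularity.NavierStokesRegularity.Theorems.palasekTowerBreakdown_assembly_proof` (its module imports this route file, so no `_holds` link can be stated here).

/-! D-0027 §2.1 — DECIDING THEOREM (planner-authored via `route open/edit --closes-file`; by planner-ns-blowup-plan-g22-0 2026-08-27T10:20:40Z):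
its hypotheses are this route's items and its conclusion the registered leaf `Summit.NavierStokesRegularity.NavierStokesRegularity.NavierStokesBreakdownR3` (board rule D-0052) (glue_lint), and it elaborates with this file. -/

@[closes "route-NavierStokesRegularity-PalasekTowerBreakdown"] theorem closes (h₁ : EpisodeBaseT) (h₂ : HeredityAtOneT) (h₃ : HeredityFromTwoT) :
    Summit.NavierStokesRegularity.NavierStokesRegularity.NavierStokesBreakdownR3 :=
  Summit.NavierStokesRegularity.FluidComputer.PalasekTowerClayBridge.navierStokesBreakdownR3_of_heredityGAt h₁ h₂ h₃

end Summit.NavierStokesRegularity.NavierStokesRegularity.Theses.PalasekTowerBreakdown
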